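import Summits.BirchSwinnertonDyer.BirchSwinnertonDyer.Theses.TeichmullerTwistDescent
import Summits.BirchSwinnertonDyer.BirchSwinnertonDyer.Theorems.TeichmullerTwistDescentCells57Residual
import HarnessLib

/-!
# Route `TeichmullerTwistDescent`, support item `SupercuspidalOptimalManinUnitFiveSevenOfCell`
# (stmt-BirchSwinnertonDyer-23887): SCMU57 GRANTED the PUB bundles and the low-discriminant cell LOW — closed by name

Cell `pub/bsd-wall` (D-0145 lines of planner bsd-idea-3; route `TeichmullerTwistDescent` rev 2, 67d75d08), seat
`bsd-line-edix-p1` (prover, g2; cc'd on idea-crit-5's verdict #5 of the re-glue). The rev-2 re-glue files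
`SupercuspidalOptimalManinUnitFiveSevenOfCell := KatoNeronAndCremonaFacts → PublishedInputsAdditiveKoly →
SupersingularTorsionOptimalManinUnitFive → SupercuspidalOptimalManinUnitFiveSeven`, consumed by `closes`: SCMU57
(stmt-BirchSwinnertonDyer-22639, Manin's `p`-part at `p ∈ {5, 7}` on the supercuspidal = non-(G)-ordinary classes)
GRANTED the PUB bundle (F″ = `kato_neron_isIntegral_twistedSymbolSum_of_additive_five_le` ∧ Cremona), the
Kolyvagin-inputs bundle (6th conjunct = modularity `exists_isNewformOf`) and the cell LOW
(stmt-BirchSwinnertonDyer-23884: Kodaira II/III at `5`, II at `7`, NOT (G)-ordinary, with a `ℚ_p`-rational point of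
order `p`). It is exactly the item form of the landed cell theorem
`TeichmullerTwistDescent.supercuspidalOptimalManinUnitFiveSeven_of_kato57_of_lowDiscriminant`
(`Theorems/TeichmullerTwistDescentCells57Residual.lean`, seat bsd-line-ttd-p2). HONEST STATUS: this closes the
SUPPORT item by name; SCMU57 itself stays conditional on F″ and on LOW. BSD is not proved by any of this.
-/

set_option autoImplicit false
-- the Theorems namespace of this sub repeats the summit name by design (D-0017 nested layout)
set_option linter.dupNamespace false

namespace Summit.BirchSwinnertonDyer.BirchSwinnertonDyer.Theorems

/-- **`SupercuspidalOptimalManinUnitFiveSevenOfCell` (stmt-BirchSwinnertonDyer-23887) holds**: GRANTED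
`KatoNeronAndCremonaFacts` (F″ ∧ Cremona), `PublishedInputsAdditiveKoly` (modularity) and the cell LOW, the crux SCMU57
`SupercuspidalOptimalManinUnitFiveSeven` — by
`TeichmullerTwistDescent.supercuspidalOptimalManinUnitFiveSeven_of_kato57_of_lowDiscriminant`.
[cite: Kato2004Asterisque, (8.1.3) (p. 180), Thm. 9.7 (p. 189)] [cite: Mazur1977, Ch. III §5, Step 1, p. 158] -/
theorem supercuspidalOptimalManinUnitFiveSevenOfCell_proof :
    Summit.BirchSwinnertonDyer.BirchSwinnertonDyer.Theses.TeichmullerTwistDescent.SupercuspidalOptimalManinUnitFiveSevenOfCell := by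
  unfold Summit.BirchSwinnertonDyer.BirchSwinnertonDyer.Theses.TeichmullerTwistDescent.SupercuspidalOptimalManinUnitFiveSevenOfCell
  intro hK hP hl
  exact TeichmullerTwistDescent.supercuspidalOptimalManinUnitFiveSeven_of_kato57_of_lowDiscriminant
    hP.2.2.2.2.2.1 hK.1 hl

end Summit.BirchSwinnertonDyer.BirchSwinnertonDyer.Theorems
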